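import Summits.Ventures.PercRepro.RankLevelSetHallRuleL

/-!
# PercRepro — THE COMPLEMENT IDENTITY: UP-NEIGHBOURHOODS FROM DOWN-NEIGHBOURHOODS, LOST SETS AND BIG SETS
(p4, gen 39; paper proofs/P4-TILT-S.md §6; C-044 at the tight layer `#E = p + q`, any `k = p − q ≥ 2`)

At the tight layer the complement `B_Z = E ∖ Z` of a member is an independent `p`-set, so the DOWN-neighbourhood of a family
`𝒜` of members is Boolean (`S' ⊆ B_Z`, `q < #S' < p`) and `Φ(p,q)·#𝒜 ≤ #N_down(𝒜)` is night-1's theorem (Boolean LYM on the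
complements, `hallDown_of_ncard_eq`).  THIS FILE: complementation `S' ↦ E ∖ S'` is a bijection from `N_down(𝒜)` minus the
complements of the LOST sets onto the UP-neighbours of size `< p`, where
  `Lost(𝒜) = {T : q < #T < p, r(T) = q, T ⊇ some Z ∈ 𝒜}` (`lostUpSets`: the rank-`q` supersets of the members, inside their closure flats)
  `Big(𝒜)  = {S ∈ N_up(𝒜) : #S ≥ p}` (`bigUpSets`: the UP-neighbours of size `≥ p`, which have no DOWN counterpart).
Hence the EXACT IDENTITY (`upNbhd_ncard_add_lost`):  `#N_up(𝒜) + #Lost(𝒜) = #N_down(𝒜) + #Big(𝒜)`,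
and the UP-Hall condition for `𝒜` holds as soon as `#Lost(𝒜) ≤ #Big(𝒜)` (`hallUp_of_lost_le_big`).  In particular
(`hallUp_of_lostBigInj`) an INJECTION `μ` of the lost sets of the whole cell into the big sets with `T ⊆ μ(T)` gives C-044 UP
for every family — a weight-free, `Φ`-free Hall condition between two families of supersets of the members (evidence, p4 g39:
the inclusion graph Lost → Big has Hall ratio `≥ 2.67` on the cell's random `n ≤ 12` census and the structured families; on
`M₀ = U_{q,q+d} ⊕ Free` the injection `T ↦ T ∪ U` is trivial).  Nothing beyond the identity and the two transfers is asserted.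

* `lostUpSets`, `bigUpSets`, `smallUpSets`, `lostUpCompl`;
* `ncard_compl_add`, `mem_downNbhd_ncard`, `mem_downNbhd_of_subset_compl`, `q_lt_ncard_of_mem_upNbhd`,
  `compl_mem_upSmall`, `compl_mem_downNbhd_of_mem_upSmall`, `compl_mem_lostSets`, `compl_mem_lostCompl`;
* `ncard_upNbhd_eq`, `ncard_downNbhd_sdiff_lostCompl`, `ncard_lostCompl`;
* **`upNbhd_ncard_add_lost`** (the identity), **`hallUp_of_lost_le_big`**, `LostBigInj`, **`hallUp_of_lostBigInj`**.
Axioms: standard.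
-/

namespace PercRepro

open Set Matroid

variable {α : Type} (M : Matroid α) [M.Finite]

/-- The LOST sets of a family `𝒜` of members: `T ⊆ E` with `q < #T < p`, `r(T) = q`, containing a member of `𝒜`
(the sets between a member and its closure flat that are not `Y`-sets). -/
def lostUpSets (p q : ℕ) (𝒜 : Set (Set α)) : Set (Set α) :=
  {T | T ⊆ M.E ∧ q < T.ncard ∧ T.ncard < p ∧ M.eRk T = (q : ℕ∞) ∧ ∃ Z ∈ 𝒜, Z ⊆ T}

/-- The BIG UP-neighbours of `𝒜`: the `S ∈ N_up(𝒜)` of size `≥ p`. -/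
def bigUpSets (p q : ℕ) (𝒜 : Set (Set α)) : Set (Set α) := {S | S ∈ upNbhd M p q 𝒜 ∧ p ≤ S.ncard}

/-- The small UP-neighbours of `𝒜`: the `S ∈ N_up(𝒜)` of size `< p`. -/
def smallUpSets (p q : ℕ) (𝒜 : Set (Set α)) : Set (Set α) := {S | S ∈ upNbhd M p q 𝒜 ∧ S.ncard < p}

/-- The DOWN-neighbours whose complement has rank `q` (the complements of the lost sets). -/
def lostUpCompl (p q : ℕ) (𝒜 : Set (Set α)) : Set (Set α) :=
  {S | S ∈ downNbhd M p q 𝒜 ∧ M.eRk (M.E \ S) = (q : ℕ∞)}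

/-- Sizes of a set and its complement add up to `p + q` at the tight layer. -/
theorem ncard_compl_add (p q : ℕ) (hE : M.E.ncard = p + q) {S : Set α} (hS : S ⊆ M.E) :
    (M.E \ S).ncard + S.ncard = p + q := by
  rw [← hE]
  exact ncard_sdiff_add_ncard_of_subset hS M.ground_finite

/-- A DOWN-neighbour of a family of members is an independent set of size strictly between `q` and `p`. -/
theorem mem_downNbhd_ncard (p q : ℕ) (hE : M.E.ncard = p + q) {𝒜 : Set (Set α)} (h𝒜 : 𝒜 ⊆ cellMembers M p q)
    {S : Set α} (hS : S ∈ downNbhd M p q 𝒜) : M.Indep S ∧ q < S.ncard ∧ S.ncard < p := by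
  obtain ⟨hSE, hq, hp, Z, hZ, hSZ⟩ := hS
  have hZm := h𝒜 hZ
  have hind : M.Indep S := (compl_indep_of_mem_U M hE hZm).1.subset hSZ
  have hSfin : S.Finite := M.set_finite S hSE
  have hrk : M.eRk S = (S.ncard : ℕ∞) := by rw [hind.eRk_eq_encard, hSfin.cast_ncard_eq]
  rw [hrk] at hq hp
  exact ⟨hind, by exact_mod_cast hq, by exact_mod_cast hp⟩

/-- Conversely, a subset of some `E ∖ Z` (`Z ∈ 𝒜`) of size strictly between `q` and `p` is a DOWN-neighbour. -/
theorem mem_downNbhd_of_subset_compl (p q : ℕ) (hE : M.E.ncard = p + q) {𝒜 : Set (Set α)}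
    (h𝒜 : 𝒜 ⊆ cellMembers M p q) {S Z : Set α} (hZ : Z ∈ 𝒜) (hSZ : S ⊆ M.E \ Z) (hq : q < S.ncard)
    (hp : S.ncard < p) : S ∈ downNbhd M p q 𝒜 := by
  have hZm := h𝒜 hZ
  have hSE : S ⊆ M.E := hSZ.trans sdiff_subset
  have hind : M.Indep S := (compl_indep_of_mem_U M hE hZm).1.subset hSZ
  have hSfin : S.Finite := M.set_finite S hSE
  have hrk : M.eRk S = (S.ncard : ℕ∞) := by rw [hind.eRk_eq_encard, hSfin.cast_ncard_eq]
  refine ⟨hSE, ?_, ?_, Z, hZ, hSZ⟩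
  · rw [hrk]; exact_mod_cast hq
  · rw [hrk]; exact_mod_cast hp

/-- An UP-neighbour has more than `q` elements (its rank exceeds `q`). -/
theorem q_lt_ncard_of_mem_upNbhd (p q : ℕ) {𝒜 : Set (Set α)} {S : Set α} (hS : S ∈ upNbhd M p q 𝒜) :
    q < S.ncard := by
  obtain ⟨hSE, hq, -, -⟩ := hS
  have hSfin : S.Finite := M.set_finite S hSE
  have h := lt_of_lt_of_le hq (M.eRk_le_encard S)
  rw [← hSfin.cast_ncard_eq] at h
  exact_mod_cast h

omit [M.Finite] in
/-- A member of `𝒜` lies in the complement of any `S ⊆ E ∖ Z`. -/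
theorem subset_compl_of_subset_sdiff {𝒜 : Set (Set α)} (p q : ℕ) (h𝒜 : 𝒜 ⊆ cellMembers M p q) {S Z : Set α}
    (hZ : Z ∈ 𝒜) (hSZ : S ⊆ M.E \ Z) : Z ⊆ M.E \ S :=
  fun _ hx => ⟨(h𝒜 hZ).1 hx, fun hxS => (hSZ hxS).2 hx⟩

/-- The complement of a DOWN-neighbour whose complement does not have rank `q` is a small UP-neighbour. -/
theorem compl_mem_upSmall (p q : ℕ) (hE : M.E.ncard = p + q) {𝒜 : Set (Set α)} (h𝒜 : 𝒜 ⊆ cellMembers M p q)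
    {S : Set α} (hS : S ∈ downNbhd M p q 𝒜) (hne : M.eRk (M.E \ S) ≠ (q : ℕ∞)) :
    M.E \ S ∈ smallUpSets M p q 𝒜 := by
  obtain ⟨hind, hq, hp⟩ := mem_downNbhd_ncard M p q hE h𝒜 hS
  obtain ⟨hSE, -, -, Z, hZ, hSZ⟩ := hS
  have hZm := h𝒜 hZ
  have hZT : Z ⊆ M.E \ S := subset_compl_of_subset_sdiff M p q h𝒜 hZ hSZ
  have hTfin : (M.E \ S).Finite := M.set_finite _ sdiff_subset
  have hcard := ncard_compl_add M p q hE hSE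
  have hTlt : (M.E \ S).ncard < p := by omega
  have hge : (q : ℕ∞) ≤ M.eRk (M.E \ S) := by
    rw [← hZm.2.1]
    exact M.eRk_mono hZT
  have hrkT : M.eRk (M.E \ S) < (p : ℕ∞) := by
    calc M.eRk (M.E \ S) ≤ (M.E \ S).encard := M.eRk_le_encard _
      _ = ((M.E \ S).ncard : ℕ∞) := hTfin.cast_ncard_eq.symm
      _ < (p : ℕ∞) := by exact_mod_cast hTlt
  exact ⟨⟨sdiff_subset, lt_of_le_of_ne hge (Ne.symm hne), hrkT, Z, hZ, hZT⟩, hTlt⟩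

/-- The complement of a small UP-neighbour is a DOWN-neighbour, and is not a lost complement. -/
theorem compl_mem_downNbhd_of_mem_upSmall (p q : ℕ) (hE : M.E.ncard = p + q) {𝒜 : Set (Set α)}
    (h𝒜 : 𝒜 ⊆ cellMembers M p q) {T : Set α} (hT : T ∈ smallUpSets M p q 𝒜) :
    M.E \ T ∈ downNbhd M p q 𝒜 ∧ M.eRk (M.E \ (M.E \ T)) ≠ (q : ℕ∞) := by
  obtain ⟨hTup, hTlt⟩ := hT
  have hqT := q_lt_ncard_of_mem_upNbhd M p q hTup
  obtain ⟨hTE, hqr, -, Z, hZ, hZT⟩ := hTup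
  have hSZ : M.E \ T ⊆ M.E \ Z := fun x hx => ⟨hx.1, fun hxZ => hx.2 (hZT hxZ)⟩
  have hcard := ncard_compl_add M p q hE hTE
  refine ⟨mem_downNbhd_of_subset_compl M p q hE h𝒜 hZ hSZ (by omega) (by omega), ?_⟩
  rw [Set.sdiff_sdiff_cancel_left hTE]
  exact ne_of_gt hqr

/-- The complement of a lost complement is a lost set. -/
theorem compl_mem_lostSets (p q : ℕ) (hE : M.E.ncard = p + q) {𝒜 : Set (Set α)} (h𝒜 : 𝒜 ⊆ cellMembers M p q)
    {S : Set α} (hS : S ∈ lostUpCompl M p q 𝒜) : M.E \ S ∈ lostUpSets M p q 𝒜 := by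
  obtain ⟨hSd, hrk⟩ := hS
  obtain ⟨-, hq, hp⟩ := mem_downNbhd_ncard M p q hE h𝒜 hSd
  obtain ⟨hSE, -, -, Z, hZ, hSZ⟩ := hSd
  have hcard := ncard_compl_add M p q hE hSE
  exact ⟨sdiff_subset, by omega, by omega, hrk, Z, hZ, subset_compl_of_subset_sdiff M p q h𝒜 hZ hSZ⟩

/-- The complement of a lost set is a lost complement. -/
theorem compl_mem_lostCompl (p q : ℕ) (hE : M.E.ncard = p + q) {𝒜 : Set (Set α)} (h𝒜 : 𝒜 ⊆ cellMembers M p q)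
    {T : Set α} (hT : T ∈ lostUpSets M p q 𝒜) : M.E \ T ∈ lostUpCompl M p q 𝒜 := by
  obtain ⟨hTE, hq, hp, hrk, Z, hZ, hZT⟩ := hT
  have hSZ : M.E \ T ⊆ M.E \ Z := fun x hx => ⟨hx.1, fun hxZ => hx.2 (hZT hxZ)⟩
  have hcard := ncard_compl_add M p q hE hTE
  refine ⟨mem_downNbhd_of_subset_compl M p q hE h𝒜 hZ hSZ (by omega) (by omega), ?_⟩
  rw [Set.sdiff_sdiff_cancel_left hTE]
  exact hrk

/-- `#N_up(𝒜) = #(small) + #(big)`. -/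
theorem ncard_upNbhd_eq (p q : ℕ) (𝒜 : Set (Set α)) :
    (upNbhd M p q 𝒜).ncard = (smallUpSets M p q 𝒜).ncard + (bigUpSets M p q 𝒜).ncard := by
  have hfin : (upNbhd M p q 𝒜).Finite := (cellY_finite M p q).subset (upNbhd_subset_cellY 𝒜 p q)
  have hsplit : upNbhd M p q 𝒜 = smallUpSets M p q 𝒜 ∪ bigUpSets M p q 𝒜 := by
    ext S
    constructor
    · intro hS
      by_cases h : S.ncard < p
      · exact Or.inl ⟨hS, h⟩
      · exact Or.inr ⟨hS, not_lt.mp h⟩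
    · rintro (h | h) <;> exact h.1
  rw [hsplit]
  apply ncard_union_eq
  · rw [Set.disjoint_left]
    intro S h1 h2
    exact absurd h2.2 (not_le.mpr h1.2)
  · exact hfin.subset (fun _ h => h.1)
  · exact hfin.subset (fun _ h => h.1)

/-- Complementation is a bijection from the DOWN-neighbours that are not lost complements onto the small UP-neighbours. -/
theorem ncard_downNbhd_sdiff_lostCompl (p q : ℕ) (hE : M.E.ncard = p + q) {𝒜 : Set (Set α)}
    (h𝒜 : 𝒜 ⊆ cellMembers M p q) :
    (downNbhd M p q 𝒜 \ lostUpCompl M p q 𝒜).ncard = (smallUpSets M p q 𝒜).ncard := by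
  apply ncard_congr (fun S _ => M.E \ S)
  · intro S hS
    exact compl_mem_upSmall M p q hE h𝒜 hS.1 (fun h => hS.2 ⟨hS.1, h⟩)
  · intro S₁ S₂ h₁ h₂ h
    rw [← Set.sdiff_sdiff_cancel_left h₁.1.1, h, Set.sdiff_sdiff_cancel_left h₂.1.1]
  · intro T hT
    obtain ⟨hd, hne⟩ := compl_mem_downNbhd_of_mem_upSmall M p q hE h𝒜 hT
    exact ⟨M.E \ T, ⟨hd, fun hl => hne hl.2⟩, Set.sdiff_sdiff_cancel_left hT.1.1⟩

/-- Complementation is a bijection from the lost complements onto the lost sets. -/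
theorem ncard_lostCompl (p q : ℕ) (hE : M.E.ncard = p + q) {𝒜 : Set (Set α)} (h𝒜 : 𝒜 ⊆ cellMembers M p q) :
    (lostUpCompl M p q 𝒜).ncard = (lostUpSets M p q 𝒜).ncard := by
  apply ncard_congr (fun S _ => M.E \ S)
  · intro S hS
    exact compl_mem_lostSets M p q hE h𝒜 hS
  · intro S₁ S₂ h₁ h₂ h
    rw [← Set.sdiff_sdiff_cancel_left h₁.1.1, h, Set.sdiff_sdiff_cancel_left h₂.1.1]
  · intro T hT
    exact ⟨M.E \ T, compl_mem_lostCompl M p q hE h𝒜 hT, Set.sdiff_sdiff_cancel_left hT.1⟩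

/-- **THE COMPLEMENT IDENTITY** (tight layer): `#N_up(𝒜) + #Lost(𝒜) = #N_down(𝒜) + #Big(𝒜)`. -/
theorem upNbhd_ncard_add_lost (p q : ℕ) (hE : M.E.ncard = p + q) {𝒜 : Set (Set α)} (h𝒜 : 𝒜 ⊆ cellMembers M p q) :
    (upNbhd M p q 𝒜).ncard + (lostUpSets M p q 𝒜).ncard = (downNbhd M p q 𝒜).ncard + (bigUpSets M p q 𝒜).ncard := by
  have hdfin : (downNbhd M p q 𝒜).Finite := (cellY_finite M p q).subset (downNbhd_subset_cellY 𝒜 p q)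
  have hsub : lostUpCompl M p q 𝒜 ⊆ downNbhd M p q 𝒜 := fun _ h => h.1
  have h1 := ncard_sdiff_add_ncard_of_subset hsub hdfin
  rw [ncard_upNbhd_eq, ← ncard_downNbhd_sdiff_lostCompl M p q hE h𝒜, ← ncard_lostCompl M p q hE h𝒜]
  omega

/-- **THE TRANSFER**: if the lost sets of `𝒜` are at most as many as its big UP-neighbours, the UP-Hall condition holds for `𝒜`
(from night-1's DOWN theorem `hallDown_of_ncard_eq` and the identity). -/
theorem hallUp_of_lost_le_big (p q : ℕ) (hE : M.E.ncard = p + q) {𝒜 : Set (Set α)} (h𝒜 : 𝒜 ⊆ cellMembers M p q)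
    (h : (lostUpSets M p q 𝒜).ncard ≤ (bigUpSets M p q 𝒜).ncard) :
    phiK p q * (𝒜.ncard : ℚ) ≤ ((upNbhd M p q 𝒜).ncard : ℚ) := by
  have hd := hallDown_of_ncard_eq (M := M) p q hE 𝒜 h𝒜
  have hid := upNbhd_ncard_add_lost M p q hE h𝒜
  have hle : (downNbhd M p q 𝒜).ncard ≤ (upNbhd M p q 𝒜).ncard := by omega
  exact hd.trans (by exact_mod_cast hle)

/-- **The injection condition** (a `Prop`, NOT asserted): a map `μ` sending every lost set of the cell (over all members) to a
big UP-neighbour containing it, injectively on the lost sets. -/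
def LostBigInj (p q : ℕ) : Prop :=
  ∃ μ : Set α → Set α, (∀ T ∈ lostUpSets M p q (cellMembers M p q), μ T ∈ bigUpSets M p q (cellMembers M p q) ∧ T ⊆ μ T) ∧
    Set.InjOn μ (lostUpSets M p q (cellMembers M p q))

omit [M.Finite] in
/-- The lost sets of a subfamily are lost sets of the cell. -/
theorem lostSets_mono (p q : ℕ) {𝒜 ℬ : Set (Set α)} (h : 𝒜 ⊆ ℬ) : lostUpSets M p q 𝒜 ⊆ lostUpSets M p q ℬ := by
  rintro T ⟨hTE, hq, hp, hrk, Z, hZ, hZT⟩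
  exact ⟨hTE, hq, hp, hrk, Z, h hZ, hZT⟩

omit [M.Finite] in
/-- A big UP-neighbour of the cell that contains a lost set of `𝒜` is a big UP-neighbour of `𝒜`. -/
theorem mem_bigSets_of_subset (p q : ℕ) {𝒜 : Set (Set α)} {T B : Set α} (hT : T ∈ lostUpSets M p q 𝒜)
    (hB : B ∈ bigUpSets M p q (cellMembers M p q)) (hTB : T ⊆ B) : B ∈ bigUpSets M p q 𝒜 := by
  obtain ⟨-, -, -, -, Z, hZ, hZT⟩ := hT
  obtain ⟨⟨hBE, hq, hp, -⟩, hcard⟩ := hB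
  exact ⟨⟨hBE, hq, hp, Z, hZ, hZT.trans hTB⟩, hcard⟩

/-- **C-044 UP AT THE TIGHT LAYER FROM THE INJECTION CONDITION**: `LostBigInj M p q` gives the UP-Hall condition for every
family of members (the injection restricts to `Lost(𝒜) → Big(𝒜)`). -/
theorem hallUp_of_lostBigInj (p q : ℕ) (hE : M.E.ncard = p + q) (h : LostBigInj M p q) (𝒜 : Set (Set α))
    (h𝒜 : 𝒜 ⊆ cellMembers M p q) :
    phiK p q * (𝒜.ncard : ℚ) ≤ ((upNbhd M p q 𝒜).ncard : ℚ) := by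
  obtain ⟨μ, hμ, hinj⟩ := h
  apply hallUp_of_lost_le_big M p q hE h𝒜
  have hbfin : (bigUpSets M p q 𝒜).Finite :=
    ((cellY_finite M p q).subset (upNbhd_subset_cellY 𝒜 p q)).subset (fun _ h => h.1)
  refine ncard_le_ncard_of_injOn μ ?_ ?_ hbfin
  · intro T hT
    have hT' := lostSets_mono M p q h𝒜 hT
    exact mem_bigSets_of_subset M p q hT (hμ T hT').1 (hμ T hT').2
  · exact hinj.mono (lostSets_mono M p q h𝒜)

end PercRepro
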